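import Mathlib

/-!
# Route RibetTakahashiSplit — item `DiscrepancyPotentialBound` (stmt-ABC-2637), part 2:
  the integral side

Helper lemmas for Serre's log-gas lemma
`Summit.ABC.ABC.Theses.RibetTakahashiSplit.DiscrepancyPotentialBound` (closed in
`RibetTakahashiSplitDiscrepancyPotentialBound.lean`), for an abstract density `ρ` on `[-L, L]`
(`0 ≤ ρ ≤ R`, `ρ = 0` off `(-L, L)`, continuous on `[-L, L]`):
* `integral_ite_Icc_eq`: `∫_{-L}^{L} 1_{[α,β]} ρ = ∫_α^β ρ`;
* `integral_level_fn_eq`: the level step function `M - h Σ_k 1_{[a-e_k, a+e_k]}` integrates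
  against `ρ` to `M ∫_{-L}^{L} ρ - h Σ_k ∫_{a-e_k}^{a+e_k} ρ`;
* `level_fn_le`: pointwise on `[-L, L]` it is `≤ log|a-t| + h + (-K - log|a-t|)⁺`
  (given the abstract level bound of part 1, taken as a hypothesis so that this file is
  independent of part 1);
* `integral_trunc_le`: the truncation error `∫_{-L}^{L} (-K - log|a-t|)⁺ ρ ≤ 2 R e^{-K}`
  (from `∫_{-c}^{c} (log c - log|u|) du = 2c`, `integral_log`).
-/

-- `Summit.<Summit>.<Problem>` is the mandated summit-side namespace (CONVENTIONS §2); for the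
-- single-conjunct summit `ABC` the two coincide, so the duplicate `ABC.ABC` is deliberate.
set_option linter.dupNamespace false

open MeasureTheory Set intervalIntegral Real Finset

namespace Summit.ABC.ABC.Theorems

namespace DiscrepancyPotentialBound

/-- Membership in the symmetric interval is the distance condition. -/
theorem mem_Icc_sub_add_iff' {a t e : ℝ} : t ∈ Set.Icc (a - e) (a + e) ↔ |a - t| ≤ e := by
  rw [Set.mem_Icc, abs_sub_le_iff]
  constructor <;> rintro ⟨h1, h2⟩ <;> constructor <;> linarith

/-- `t ↦ log |a - t|` is interval integrable on every interval. -/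
theorem intervalIntegrable_log_abs_sub (a α β : ℝ) :
    IntervalIntegrable (fun t => Real.log |a - t|) volume α β := by
  have h := (intervalIntegral.intervalIntegrable_log' (a := a - α) (b := a - β)).comp_sub_left a
  simp only [sub_sub_cancel] at h
  have he : (fun t => Real.log |a - t|) = fun t => Real.log (a - t) := by
    ext t; exact Real.log_abs _
  rw [he]; exact h

/-- The cut-off `ρ` (to a closed interval) is interval integrable on `[-L, L]`. -/
theorem intervalIntegrable_ite_Icc {L α β : ℝ} {ρ : ℝ → ℝ} (hL : -L ≤ L)
    (hρi : IntervalIntegrable ρ volume (-L) L) :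
    IntervalIntegrable (fun t => if t ∈ Set.Icc α β then ρ t else 0) volume (-L) L := by
  have h1 : (fun t => if t ∈ Set.Icc α β then ρ t else 0) = (Set.Icc α β).indicator ρ := by
    ext t; simp only [Set.indicator_apply]
  rw [h1, intervalIntegrable_iff_integrableOn_Ioc_of_le hL] at *
  exact hρi.indicator measurableSet_Icc

/-- Integral over `[-L, L]` of `ρ` cut to `[α, β]` equals `∫_α^β ρ` when `ρ` vanishes
off `(-L, L)`. -/
theorem integral_ite_Icc_eq {L α β : ℝ} (ρ : ℝ → ℝ) (hL : -L ≤ L) (hαβ : α ≤ β)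
    (hρoff : ∀ t, t ∉ Set.Ioo (-L) L → ρ t = 0) :
    (∫ t in (-L)..L, (if t ∈ Set.Icc α β then ρ t else 0)) = ∫ t in α..β, ρ t := by
  rw [intervalIntegral.integral_of_le hL, intervalIntegral.integral_of_le hαβ]
  have h1 : (fun t => if t ∈ Set.Icc α β then ρ t else 0) = (Set.Icc α β).indicator ρ := by
    ext t; simp only [Set.indicator_apply]
  rw [h1, MeasureTheory.integral_indicator measurableSet_Icc,
    Measure.restrict_restrict measurableSet_Icc]
  have h2 : ∫ t in Set.Ioc α β, ρ t = ∫ t in Set.Ioc α β ∩ Set.Ioc (-L) L, ρ t := by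
    apply MeasureTheory.setIntegral_eq_of_subset_of_forall_sdiff_eq_zero measurableSet_Ioc
      Set.inter_subset_left
    intro t ht
    apply hρoff
    intro htI
    exact ht.2 ⟨ht.1, htI.1, htI.2.le⟩
  rw [h2]
  apply MeasureTheory.setIntegral_congr_set
  exact (Ioc_ae_eq_Icc (μ := (volume : Measure ℝ))).symm.inter (ae_eq_refl _)

/-- Integral of the level step function against `ρ`, through the interval masses. -/
theorem integral_level_fn_eq {L M h a : ℝ} {N : ℕ} (ρ : ℝ → ℝ) (e : ℕ → ℝ) (hL : -L ≤ L)
    (he : ∀ k, 0 < e k)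
    (hρoff : ∀ t, t ∉ Set.Ioo (-L) L → ρ t = 0) (hρi : IntervalIntegrable ρ volume (-L) L) :
    (∫ t in (-L)..L, (M - h * ∑ k ∈ Finset.range N,
        (if t ∈ Set.Icc (a - e k) (a + e k) then (1:ℝ) else 0)) * ρ t)
      = M * (∫ t in (-L)..L, ρ t)
        - h * (∑ k ∈ Finset.range N, ∫ t in (a - e k)..(a + e k), ρ t) := by
  have hpt : ∀ t, (M - h * ∑ k ∈ Finset.range N,
        (if t ∈ Set.Icc (a - e k) (a + e k) then (1:ℝ) else 0)) * ρ t
      = M * ρ t - h * ∑ k ∈ Finset.range N,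
          (if t ∈ Set.Icc (a - e k) (a + e k) then ρ t else 0) := by
    intro t
    rw [sub_mul, mul_assoc, Finset.sum_mul]
    congr 2
    refine Finset.sum_congr rfl (fun k _ => ?_)
    split_ifs <;> simp
  simp_rw [hpt]
  have hI : ∀ k ∈ Finset.range N, IntervalIntegrable
      (fun t => if t ∈ Set.Icc (a - e k) (a + e k) then ρ t else 0) volume (-L) L :=
    fun k _ => intervalIntegrable_ite_Icc hL hρi
  have hIsum : IntervalIntegrable (fun t => ∑ k ∈ Finset.range N,
      (if t ∈ Set.Icc (a - e k) (a + e k) then ρ t else 0)) volume (-L) L := by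
    have := IntervalIntegrable.sum (Finset.range N) hI
    have hfun : (∑ k ∈ Finset.range N,
          fun t => if t ∈ Set.Icc (a - e k) (a + e k) then ρ t else 0)
        = fun t => ∑ k ∈ Finset.range N,
            (if t ∈ Set.Icc (a - e k) (a + e k) then ρ t else 0) := by
      ext t; simp only [Finset.sum_apply]
    rw [hfun] at this; exact this
  rw [intervalIntegral.integral_sub (hρi.const_mul M) (hIsum.const_mul h),
    intervalIntegral.integral_const_mul, intervalIntegral.integral_const_mul,
    intervalIntegral.integral_finsetSum hI]
  congr 2
  refine Finset.sum_congr rfl (fun k _ => ?_)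
  exact integral_ite_Icc_eq ρ hL (by linarith [he k]) hρoff

/-- The truncation `t ↦ (-K - log |a - t|)⁺` is interval integrable on every interval. -/
theorem intervalIntegrable_trunc (K a α β : ℝ) :
    IntervalIntegrable (fun t => max (-K - Real.log |a - t|) 0) volume α β := by
  have h1 := (intervalIntegrable_const (c := -K) (μ := volume) (a := α) (b := β)).sub
    (intervalIntegrable_log_abs_sub a α β)
  exact ⟨h1.1.pos_part, h1.2.pos_part⟩

/-- The truncation error integral: `∫_{-L}^{L} (-K - log|a-t|)⁺ ρ(t) dt ≤ 2 R e^{-K}`. -/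
theorem integral_trunc_le {L K R a : ℝ} (ρ : ℝ → ℝ) (hL : -L ≤ L) (hR : 0 ≤ R)
    (hρR : ∀ t, ρ t ≤ R) (hρc : ContinuousOn ρ (Set.Icc (-L) L)) :
    (∫ t in (-L)..L, max (-K - Real.log |a - t|) 0 * ρ t) ≤ 2 * R * Real.exp (-K) := by
  set c := Real.exp (-K) with hc
  have hc0 : 0 < c := Real.exp_pos _
  have hlogc : Real.log c = -K := Real.log_exp _
  set w : ℝ → ℝ := fun t => max (-K - Real.log |a - t|) 0 with hw
  -- integrability of `w` on any interval
  have hwi : ∀ α β : ℝ, IntervalIntegrable w volume α β := fun α β =>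
    intervalIntegrable_trunc K a α β
  have hw0 : ∀ t, 0 ≤ w t := fun t => le_max_right _ _
  have hwoff : ∀ t, t ∉ Set.Icc (a - c) (a + c) → w t = 0 := by
    intro t ht
    rw [mem_Icc_sub_add_iff', not_le] at ht
    have h1 : -K < Real.log |a - t| := by
      rw [← hlogc]; exact Real.log_lt_log hc0 ht
    simp only [hw]
    exact max_eq_right (by linarith)
  -- step 1: `∫_J w ρ ≤ R ∫_J w`
  have s1 : (∫ t in (-L)..L, w t * ρ t) ≤ ∫ t in (-L)..L, R * w t := by
    apply intervalIntegral.integral_mono_on hL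
    · exact (hwi _ _).mul_continuousOn (by rwa [Set.uIcc_of_le hL])
    · exact (hwi _ _).const_mul R
    · intro t _
      calc w t * ρ t ≤ w t * R := mul_le_mul_of_nonneg_left (hρR t) (hw0 t)
        _ = R * w t := mul_comm _ _
  -- step 2: `∫_J w ≤ ∫_{a-c}^{a+c} w`
  have s2 : (∫ t in (-L)..L, w t) ≤ ∫ t in (a - c)..(a + c), w t := by
    rw [intervalIntegral.integral_of_le hL, intervalIntegral.integral_of_le (by linarith),
      MeasureTheory.setIntegral_eq_of_subset_of_forall_sdiff_eq_zero
        (s := Set.Ioc (-L) L ∩ Set.Icc (a - c) (a + c)) measurableSet_Ioc Set.inter_subset_left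
        (fun t ht => hwoff t (fun htI => ht.2 ⟨ht.1, htI⟩))]
    calc ∫ t in Set.Ioc (-L) L ∩ Set.Icc (a - c) (a + c), w t
        ≤ ∫ t in Set.Icc (a - c) (a + c), w t := by
          apply MeasureTheory.setIntegral_mono_set
          · exact (integrableOn_Icc_iff_integrableOn_Ioc).mpr (hwi (a - c) (a + c)).1
          · exact Filter.Eventually.of_forall (fun t => hw0 t)
          · exact (Set.inter_subset_right :
              Set.Ioc (-L) L ∩ Set.Icc (a - c) (a + c) ⊆ _).eventuallyLE
      _ = ∫ t in Set.Ioc (a - c) (a + c), w t := MeasureTheory.integral_Icc_eq_integral_Ioc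
  -- step 3: `∫_{a-c}^{a+c} w = 2c`
  have s3 : (∫ t in (a - c)..(a + c), w t) = 2 * c := by
    have hae : ∀ᵐ t ∂(volume : Measure ℝ), t ∈ Set.uIoc (a - c) (a + c) →
        w t = (-K) - Real.log |a - t| := by
      have hne : ∀ᵐ t ∂(volume : Measure ℝ), t ∉ ({a} : Set ℝ) :=
        measure_eq_zero_iff_ae_notMem.mp Real.volume_singleton
      filter_upwards [hne] with t hta ht
      rw [Set.uIoc_of_le (by linarith)] at ht
      have hta' : t ≠ a := fun h' => hta (Set.mem_singleton_iff.mpr h')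
      have hr : 0 < |a - t| := abs_pos.mpr (sub_ne_zero.mpr (Ne.symm hta'))
      have hle : |a - t| ≤ c := mem_Icc_sub_add_iff'.mp ⟨ht.1.le, ht.2⟩
      have h1 : Real.log |a - t| ≤ -K := by
        rw [← hlogc]; exact Real.log_le_log hr hle
      simp only [hw]
      exact max_eq_left (by linarith)
    rw [intervalIntegral.integral_congr_ae hae,
      intervalIntegral.integral_sub intervalIntegrable_const (intervalIntegrable_log_abs_sub a _ _),
      intervalIntegral.integral_const]
    have hI : (∫ t in (a - c)..(a + c), Real.log |a - t|) = 2 * c * Real.log c - 2 * c := by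
      have h1 := intervalIntegral.integral_comp_sub_left (fun u => Real.log |u|) a
        (a := a - c) (b := a + c)
      rw [h1, show a - (a + c) = -c by ring, show a - (a - c) = c by ring]
      simp only [Real.log_abs]
      rw [integral_log]
      simp only [Real.log_neg_eq_log]
      ring
    rw [hI, smul_eq_mul, hlogc]
    ring
  -- combine
  calc (∫ t in (-L)..L, w t * ρ t) ≤ ∫ t in (-L)..L, R * w t := s1
    _ = R * ∫ t in (-L)..L, w t := intervalIntegral.integral_const_mul _ _
    _ ≤ R * ∫ t in (a - c)..(a + c), w t := mul_le_mul_of_nonneg_left s2 hR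
    _ = 2 * R * c := by rw [s3]; ring

/-- Pointwise bound: the level step function is below `log |a-t| + h + (-K - log |a-t|)⁺`
on `[-L, L]`. -/
theorem level_fn_le {L M K h a t : ℝ} {N : ℕ} (hN : 0 < N) (hh : h = (M + K) / N)
    (hMK : 0 < M + K) (hK : 0 ≤ K) (hLM : Real.log (2 * L) ≤ M) (ha : |a| ≤ L)
    (ht : t ∈ Set.Icc (-L) L)
    (hlevel : ∀ r : ℝ, 0 < r → Real.log r ≤ M →
      M - h * ((Finset.range N).filter
        (fun k : ℕ => r ≤ Real.exp (M - ((k:ℝ) + 1) * h))).card ≤ max (Real.log r) (-K) + h) :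
    M - h * ∑ k ∈ Finset.range N,
        (if t ∈ Set.Icc (a - Real.exp (M - ((k:ℝ) + 1) * h)) (a + Real.exp (M - ((k:ℝ) + 1) * h))
          then (1:ℝ) else 0)
      ≤ Real.log |a - t| + h + max (-K - Real.log |a - t|) 0 := by
  have hN' : (0 : ℝ) < N := by exact_mod_cast hN
  have hpos : 0 < h := by rw [hh]; exact div_pos hMK hN'
  have hhN : h * N = M + K := by rw [hh]; field_simp
  by_cases hta : t = a
  · rw [hta]
    have hs : (∑ k ∈ Finset.range N,
        (if a ∈ Set.Icc (a - Real.exp (M - ((k:ℝ) + 1) * h)) (a + Real.exp (M - ((k:ℝ) + 1) * h))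
          then (1:ℝ) else 0)) = N := by
      rw [Finset.sum_congr rfl (fun k _ => if_pos (by
        rw [mem_Icc_sub_add_iff']; simp [(Real.exp_pos _).le]))]
      simp
    rw [hs, sub_self, abs_zero, Real.log_zero, sub_zero, max_eq_right (by linarith)]
    linarith
  · have hr : 0 < |a - t| := abs_pos.mpr (sub_ne_zero.mpr (Ne.symm hta))
    have h2L : |a - t| ≤ 2 * L := by
      have := abs_le.mpr ⟨ht.1, ht.2⟩
      calc |a - t| ≤ |a| + |t| := abs_sub _ _
        _ ≤ L + L := add_le_add ha this
        _ = 2 * L := by ring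
    have hrM : Real.log |a - t| ≤ M := (Real.log_le_log hr h2L).trans hLM
    have hsum : (∑ k ∈ Finset.range N,
        (if t ∈ Set.Icc (a - Real.exp (M - ((k:ℝ) + 1) * h)) (a + Real.exp (M - ((k:ℝ) + 1) * h))
          then (1:ℝ) else 0))
        = (((Finset.range N).filter
            (fun k : ℕ => |a - t| ≤ Real.exp (M - ((k:ℝ) + 1) * h))).card : ℝ) := by
      rw [Finset.natCast_card_filter]
      refine Finset.sum_congr rfl (fun k _ => ?_)
      simp only [mem_Icc_sub_add_iff']
    rw [hsum]
    have h1 := hlevel _ hr hrM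
    have h2 : max (Real.log |a - t|) (-K) ≤ Real.log |a - t| + max (-K - Real.log |a - t|) 0 := by
      rcases le_total (Real.log |a - t|) (-K) with h3 | h3
      · rw [max_eq_right h3, max_eq_left (by linarith)]; linarith
      · rw [max_eq_left h3, max_eq_right (by linarith)]; linarith
    linarith

end DiscrepancyPotentialBound

end Summit.ABC.ABC.Theorems
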